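import Literature.NumberTheory.Transcendental.SemialgebraicMaps
import Literature.ModelTheory.ExponentialFields.TarskiSeidenbergProofs
import Mathlib.Data.Sign.Defs
import Mathlib.Logic.Equiv.Fin.Basic
import HarnessLib

/-!
# Sign conditions and the Tarski–Seidenberg theorem over arbitrary finite index types

Topic `Literature/ModelTheory/ExponentialFields`.  Two book-keeping consequences of the tree's
semialgebraic geometry (`Semialgebraic.lean`, `SemialgebraicMaps.lean`, Tarski–Seidenberg
`tarski_seidenberg_real_holds`) in the shape used by the Denef–van den Dries elimination for
`ℝ_an`:

* **Every semialgebraic set is sign-determined by finitely many polynomials**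
  (`IsSemialgebraic.exists_finset_signDetermined`): there is a finite family `F` of polynomials
  such that membership in `s` only depends on the sign vector `(sign p(x))_{p ∈ F}` (immediate
  from the definition as the Boolean algebra generated by the sets `{p = 0}`, `{p > 0}`;
  J. Bochnak, M. Coste, M.-F. Roy, *Real Algebraic Geometry* (1998), §2.1).
* **Tarski–Seidenberg, eliminating one distinguished coordinate** (`tarski_seidenberg_option`):
  for a finite index type `M` and a `k`-semialgebraic `S ⊆ ℝ^{Option M}`, the set
  `{c ∈ ℝ^M | ∃ t, (c, t) ∈ S}` is `k`-semialgebraic (transport of the tree's last-coordinate form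
  through coordinate permutations, which are polynomial maps).

Everything is proved; no named facts.

## References

* J. Bochnak, M. Coste, M.-F. Roy, *Real Algebraic Geometry*, Springer (1998), §2.1, Thm. 2.2.1.
  [BochnakCosteRoy1998]
* J. Denef, L. van den Dries, *p-adic and real subanalytic sets*, Ann. of Math. 128 (1988), §4
  ("eliminated by Tarski's process"). [DenefvandenDries1988]
-/

noncomputable section

open Set MvPolynomial

namespace Literature.ModelTheory.ExponentialFields

universe u

variable {k : Type*} [CommRing k]

/-! ### 1. Sign-determination by finitely many polynomials -/

section Signs

variable {R : Type*} [CommRing R] [LinearOrder R] [Algebra k R] {ι : Type*}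

/-- A set `s` is **sign-determined** by a family `F` of polynomials: membership in `s` only depends
on the signs of the `p ∈ F`. [cite: BochnakCosteRoy1998, §2.1] -/
def SignDetermined (F : Finset (MvPolynomial ι k)) (s : Set (ι → R)) : Prop :=
  ∀ x y : ι → R, (∀ p ∈ F, SignType.sign (aeval x p) = SignType.sign (aeval y p)) → (x ∈ s ↔ y ∈ s)

/-- Sign-determination is monotone in the family. [folklore] -/
theorem SignDetermined.mono {F G : Finset (MvPolynomial ι k)} (h : F ⊆ G) {s : Set (ι → R)}
    (hs : SignDetermined F s) : SignDetermined G s :=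
  fun x y hxy => hs x y fun p hp => hxy p (h hp)

/-- Sign-determined sets are stable under complement. [folklore] -/
theorem SignDetermined.compl {F : Finset (MvPolynomial ι k)} {s : Set (ι → R)}
    (hs : SignDetermined F s) : SignDetermined F sᶜ :=
  fun x y hxy => not_congr (hs x y hxy)

/-- Sign-determined sets are stable under union. [folklore] -/
theorem SignDetermined.union {F : Finset (MvPolynomial ι k)} {s t : Set (ι → R)}
    (hs : SignDetermined F s) (ht : SignDetermined F t) : SignDetermined F (s ∪ t) :=
  fun x y hxy => or_congr (hs x y hxy) (ht x y hxy)

/-- Sign-determined sets are stable under intersection. [folklore] -/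
theorem SignDetermined.inter {F : Finset (MvPolynomial ι k)} {s t : Set (ι → R)}
    (hs : SignDetermined F s) (ht : SignDetermined F t) : SignDetermined F (s ∩ t) :=
  fun x y hxy => and_congr (hs x y hxy) (ht x y hxy)

/-- **Every `k`-semialgebraic set is sign-determined by a finite family of polynomials over `k`.**
[cite: BochnakCosteRoy1998, §2.1] -/
theorem IsSemialgebraic.exists_finset_signDetermined [DecidableEq (MvPolynomial ι k)]
    {s : Set (ι → R)} (hs : IsSemialgebraic k s) :
    ∃ F : Finset (MvPolynomial ι k), SignDetermined F s := by
  induction hs using BooleanSubalgebra.closure_bot_sup_induction with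
  | mem t ht =>
    rcases ht with ⟨p, rfl⟩ | ⟨p, rfl⟩
    · refine ⟨{p}, fun x y hxy => ?_⟩
      have h := hxy p (Finset.mem_singleton_self p)
      simp only [mem_setOf_eq]
      rw [← sign_eq_zero_iff, ← sign_eq_zero_iff (a := aeval y p), h]
    · refine ⟨{p}, fun x y hxy => ?_⟩
      have h := hxy p (Finset.mem_singleton_self p)
      simp only [mem_setOf_eq]
      rw [← sign_eq_one_iff, ← sign_eq_one_iff (a := aeval y p), h]
  | bot => exact ⟨∅, fun x y _ => by simp⟩
  | sup t _ u _ ht hu =>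
    obtain ⟨F, hF⟩ := ht
    obtain ⟨G, hG⟩ := hu
    exact ⟨F ∪ G, (hF.mono Finset.subset_union_left).union (hG.mono Finset.subset_union_right)⟩
  | compl t _ ht =>
    obtain ⟨F, hF⟩ := ht
    exact ⟨F, hF.compl⟩

/-- Conversely, a set sign-determined by finitely many polynomials is semialgebraic (over a
linearly ordered ring): it is the union of the realised sign cells. [cite: BochnakCosteRoy1998, §2.1] -/
theorem SignDetermined.isSemialgebraic [IsStrictOrderedRing R] {F : Finset (MvPolynomial ι k)}
    {s : Set (ι → R)} (hs : SignDetermined F s) : IsSemialgebraic k s := by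
  classical
  -- the sign cell of a point
  set cell : (ι → R) → Set (ι → R) :=
    fun x => ⋂ p ∈ F, {y | SignType.sign (aeval y p) = SignType.sign (aeval x p)} with hcell
  have hcell_sa : ∀ x, IsSemialgebraic k (cell x) := by
    intro x
    refine IsSemialgebraic.biInter F _ fun p _ => ?_
    rcases lt_trichotomy (aeval x p) 0 with h | h | h
    · convert isSemialgebraic_setOf_eval_pos (R := R) (-p) using 1
      ext y
      simp only [mem_setOf_eq, sign_neg h, sign_eq_neg_one_iff, map_neg, neg_pos]
    · convert isSemialgebraic_setOf_eval_eq_zero (R := R) p using 1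
      ext y
      simp only [mem_setOf_eq, h, sign_zero, sign_eq_zero_iff]
    · convert isSemialgebraic_setOf_eval_pos (R := R) p using 1
      ext y
      simp only [mem_setOf_eq, sign_pos h, sign_eq_one_iff]
  -- `s` is the union of the cells of its points; finitely many distinct cells occur
  set σ : (ι → R) → (F → SignType) := fun x p => SignType.sign (aeval x (p : MvPolynomial ι k)) with hσ
  have hcell_eq : ∀ x, cell x = σ ⁻¹' {σ x} := by
    intro x; ext y
    simp only [hcell, hσ, mem_iInter, mem_setOf_eq, mem_preimage, mem_singleton_iff, funext_iff,
      Subtype.forall]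
  have hs_eq : s = ⋃ v ∈ (Finset.univ : Finset (F → SignType)).filter (fun v => ∃ x ∈ s, σ x = v), σ ⁻¹' {v} := by
    ext y
    simp only [mem_iUnion, Finset.mem_filter, Finset.mem_univ, true_and, mem_preimage,
      mem_singleton_iff, exists_prop]
    constructor
    · intro hy; exact ⟨σ y, ⟨y, hy, rfl⟩, rfl⟩
    · rintro ⟨v, ⟨x, hx, rfl⟩, hyx⟩
      refine (hs y x fun p hp => ?_).mpr hx
      have := congrFun hyx ⟨p, hp⟩
      exact this
  rw [hs_eq]
  refine IsSemialgebraic.biUnion _ _ fun v hv => ?_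
  obtain ⟨x, -, rfl⟩ := (Finset.mem_filter.mp hv).2
  rw [← hcell_eq]; exact hcell_sa x

end Signs

/-! ### 2. Tarski–Seidenberg with a distinguished coordinate -/

section Tarski

variable [Algebra k ℝ] {M : Type u} [Finite M]

/-- **Tarski–Seidenberg, `Option`-coordinate form**: projecting a `k`-semialgebraic
`S ⊆ ℝ^{Option M}` along the coordinate `none` gives a `k`-semialgebraic subset of `ℝ^M`.
[cite: BochnakCosteRoy1998, Thm. 2.2.1] -/
theorem tarski_seidenberg_option {S : Set (Option M → ℝ)} (hS : IsSemialgebraic k S) :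
    IsSemialgebraic k {c : M → ℝ | ∃ t : ℝ, (fun o : Option M => Option.elim o t c) ∈ S} := by
  classical
  set n := Nat.card M with hn
  set em : M ≃ Fin n := Finite.equivFin M with hem
  -- `Option M ≃ Fin (n + 1)`, `none ↦ last`, `some m ↦ castSucc (em m)`
  set E : Option M ≃ Fin (n + 1) := (em.optionCongr).trans finSuccEquivLast.symm with hE
  have hE_none : E none = Fin.last n := by simp [hE]
  have hE_some : ∀ m, E (some m) = Fin.castSucc (em m) := fun m => by
    simp [hE, finSuccEquivLast_symm_some]
  -- transport `S` to `Fin (n+1)`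
  set S' : Set (Fin (n + 1) → ℝ) := (fun z : Fin (n + 1) → ℝ => fun o : Option M => z (E o)) ⁻¹' S
    with hS'
  have hS'sa : IsSemialgebraic k S' := by
    have := hS.preimage_aeval (ι := Fin (n + 1)) (fun o : Option M => (X (E o) : MvPolynomial (Fin (n + 1)) k))
    convert this using 2
    ext z o; simp
  have hT := tarski_seidenberg_real_holds (k := k) hS'sa
  -- pull back along `c ↦ c ∘ em.symm`
  have hpre := hT.preimage_aeval (ι := M) (fun i : Fin n => (X (em.symm i) : MvPolynomial M k))
  convert hpre using 1
  ext c
  simp only [mem_setOf_eq, mem_preimage, mem_image, aeval_X]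
  constructor
  · rintro ⟨t, ht⟩
    refine ⟨fun j => Option.elim (E.symm j) t c, ?_, ?_⟩
    · change (fun o : Option M => Option.elim (E.symm (E o)) t c) ∈ S
      simpa using ht
    · funext i
      change Option.elim (E.symm (Fin.castSucc i)) t c = c (em.symm i)
      rw [show Fin.castSucc i = E (some (em.symm i)) by rw [hE_some]; simp, Equiv.symm_apply_apply]
      rfl
  · rintro ⟨z, hz, hzc⟩
    refine ⟨z (Fin.last n), ?_⟩
    have : (fun o : Option M => Option.elim o (z (Fin.last n)) c) = fun o => z (E o) := by
      funext o
      rcases o with _ | m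
      · simp [hE_none]
      · simp only [Option.elim_some, hE_some]
        have := congrFun hzc (em m)
        simp only [Function.comp_apply, Equiv.symm_apply_apply] at this
        exact this.symm
    rw [this]; exact hz

end Tarski

end Literature.ModelTheory.ExponentialFields
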